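import Summits.BirchSwinnertonDyer.BirchSwinnertonDyer.Theorems.Rank1ResidualX9TwistCriterion
import Literature.NumberTheory.EllipticCurves.ModularityVersionApProofs
import Mathlib.NumberTheory.LSeries.PrimesInAP
import Mathlib.Data.Nat.ChineseRemainder
import Mathlib.FieldTheory.Finite.Basic
import HarnessLib

/-!
# Route `SignedBalanceX9`, crux `TwistedAnalyticMuZeroCoprimeX9` (item stmt-BirchSwinnertonDyer-25216),
# line `coprime-frame`: stub (F) `stub_twistSideDiscriminantX9` — the REAL-QUADRATIC side `d_F`
# of a BCS-admissible pair exists (Dirichlet + CRT)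

HONEST FRAMING: this file proves ONE registered stub of the BC3 skeleton of the crux
(`Cruxes/TwistedAnalyticMuZeroCoprimeX9`, skeleton sha `3583344c0151385b…`, planner bsd-idea-2 g3),
verbatim as stated there (`Stmt.stub_twistSideDiscriminantX9`), by elementary number theory; it does
not prove the crux, the other two stubs (K: class-number-coprime imaginary discriminants; U:
Greenberg `μ = 0` on the twists), the route, or BSD. No named fact, no `sorry`; the only
definition is the statement abbreviation `Stmt.stub_twistSideDiscriminantX9` — the registered stub
signature re-homed VERBATIM (the gate credits the header
`theorem stub_twistSideDiscriminantX9 : Stmt.stub_twistSideDiscriminantX9 := …`, and the skeleton, a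
pub / `Cruxes/` file, is not importable from `Theorems/`), with its kernel-closed witness here.

**Statement (F).** For an X9 pair `(W, p)` (`ClassX9 W p`: in particular `p ≥ 5` of good
reduction) there is an integer `d_F > 1`, square-free, `d_F ≡ 1 (mod 4)`, with `p` inert in
`ℚ(√d_F)`, every prime `ℓ ∣ N_W` inert in `ℚ(√d_F)` if `p ∣ ℓ + 1` and split otherwise, and
`d_F ≠ 5` when `p = 5` — the `F`-half of `BCSAdmissiblePair` (Burungale–Castella–Skinner 2025,
arXiv:2405.00270, Lemma 5.2.3: "the splitting conditions are independent, so such fields exist by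
Dirichlet").

**Proof.** `p ∤ N_W` by good reduction (`WeierstrassCurve.dvd_conductorNorm_iff_not_hasGoodReductionAtPrime`,
the tree's unconditional form of Silverman ATAEC IV.10.2(a)). Choose, by the Chinese remainder
theorem (`Nat.chineseRemainderOfFinset`), a class `k` with `k ≡ 1 (mod 8)`, `k ≡` a quadratic
non-residue `(mod p)`, and for every odd prime `ℓ ∣ N_W`: `k ≡` a non-residue `(mod ℓ)` if
`p ∣ ℓ + 1`, `k ≡ 1 (mod ℓ)` otherwise (non-residues exist modulo odd primes:
`FiniteField.exists_nonsquare`). The class is prime to the modulus, so Dirichlet's theorem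
(Mathlib `Nat.forall_exists_prime_gt_and_eq_mod`) gives a prime `q` in it; `d_F := q` works
(a prime is square-free; `q ≡ 1 (mod 8)` gives `q ≡ 1 (mod 4)` and `2` split; at odd `ℓ` the
residue symbol is read off the congruence; `q ≠ 5 = p` since `p` is inert).

References: [BurungaleCastellaSkinner2025] Lemma 5.2.3 (arXiv:2405.00270v2);
J. Neukirch, *Algebraic Number Theory*, I.8.5 (decomposition of primes in quadratic fields).
-/

-- the summit and its single problem are both named `BirchSwinnertonDyer` (registry layout D-0017)
set_option linter.dupNamespace false
set_option autoImplicit false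

open WeierstrassCurve
open Summit.BirchSwinnertonDyer.BirchSwinnertonDyer.Rank1Residual

namespace Summit.BirchSwinnertonDyer.BirchSwinnertonDyer.Theorems.SignedBalanceX9CoprimeFrame

/-- Modulo an odd prime `ℓ` there is a quadratic non-residue, represented by a natural number
(`FiniteField.exists_nonsquare` in `ZMod ℓ`). [folklore] -/
theorem exists_nat_not_isSquare_zmod {ℓ : ℕ} (hℓ : ℓ.Prime) (hℓ2 : ℓ ≠ 2) :
    ∃ n : ℕ, ¬ IsSquare (n : ZMod ℓ) := by
  haveI := Fact.mk hℓ
  obtain ⟨x, hx⟩ := FiniteField.exists_nonsquare (F := ZMod ℓ) (by rwa [ZMod.ringChar_zmod_n])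
  exact ⟨x.val, by rwa [ZMod.natCast_zmod_val]⟩

/-- A quadratic non-residue modulo `ℓ` is prime to `ℓ` (`0` is a square). [folklore] -/
theorem not_dvd_of_not_isSquare_zmod {ℓ n : ℕ} (h : ¬ IsSquare (n : ZMod ℓ)) : ¬ ℓ ∣ n := by
  intro hdvd
  apply h
  rw [(ZMod.natCast_eq_zero_iff n ℓ).mpr hdvd]
  exact IsSquare.zero

/-- If `q ≡ n (mod ℓ)` with `n` a quadratic non-residue modulo the odd prime `ℓ`, then `ℓ` is
inert in `ℚ(√q)` in the sense of `InertInQuadField` (`ℓ ∤ q` and `q` is a non-square mod `ℓ`).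
Neukirch I.8.5. [folklore] -/
theorem inertInQuadField_of_modEq_nonsquare {q n ℓ : ℕ} (hℓ2 : ℓ ≠ 2) (hqn : q ≡ n [MOD ℓ])
    (hn : ¬ IsSquare (n : ZMod ℓ)) : InertInQuadField (q : ℤ) ℓ := by
  have hcast : ((q : ℤ) : ZMod ℓ) = (n : ZMod ℓ) := by
    rw [Int.cast_natCast, ZMod.natCast_eq_natCast_iff]
    exact hqn
  refine ⟨?_, fun h => absurd h hℓ2, fun _ => by rw [hcast]; exact hn⟩
  intro hdvd
  apply hn
  rw [← hcast, (ZMod.intCast_zmod_eq_zero_iff_dvd (q : ℤ) ℓ).mpr hdvd]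
  exact IsSquare.zero

/-- If `q ≡ 1 (mod ℓ)` for an odd prime `ℓ`, then `ℓ` splits in `ℚ(√q)` in the sense of
`SplitsInQuadField` (`ℓ ∤ q` and `q ≡ 1` is a square mod `ℓ`). Neukirch I.8.5. [folklore] -/
theorem splitsInQuadField_of_modEq_one {q ℓ : ℕ} (hℓ : ℓ.Prime) (hℓ2 : ℓ ≠ 2)
    (hq1 : q ≡ 1 [MOD ℓ]) : SplitsInQuadField (q : ℤ) ℓ := by
  haveI := Fact.mk hℓ
  have hcast : ((q : ℤ) : ZMod ℓ) = 1 := by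
    rw [Int.cast_natCast, ← Nat.cast_one, ZMod.natCast_eq_natCast_iff]
    exact hq1
  refine ⟨?_, fun h => absurd h hℓ2, fun _ => ⟨1, by rw [hcast, mul_one]⟩⟩
  intro hdvd
  have h0 := (ZMod.intCast_zmod_eq_zero_iff_dvd (q : ℤ) ℓ).mpr hdvd
  rw [hcast] at h0
  exact one_ne_zero h0

/-- If `q ≡ 1 (mod 8)` then `2` splits in `ℚ(√q)` in the sense of `SplitsInQuadField`
(`q` odd and `q ≡ 1 (mod 8)`). Neukirch I.8.5. [folklore] -/
theorem splitsInQuadField_two_of_modEq_one {q : ℕ} (hq : q ≡ 1 [MOD 8]) :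
    SplitsInQuadField (q : ℤ) 2 := by
  have h8 : q % 8 = 1 := hq
  exact ⟨by omega, fun _ => by omega, fun h => absurd rfl h⟩

/-- **The content of stub (F) of the `coprime-frame` skeleton of crux
`TwistedAnalyticMuZeroCoprimeX9` (route `SignedBalanceX9`), verbatim:** for every X9 pair `(W, p)`
there is a real quadratic discriminant `d_F > 1`, square-free, `≡ 1 (mod 4)`, with `p` inert, the
BCS-prescribed behaviour at every prime `ℓ ∣ N_W` (inert if `p ∣ ℓ + 1`, split otherwise) and
`d_F ≠ 5` when `p = 5` — the `F`-side of `BCSAdmissiblePair` (Burungale–Castella–Skinner 2025,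
Lemma 5.2.3). Proof: `d_F` a prime `q ≡ 1 (mod 8)` in a Chinese-remainder class (non-residue mod
`p`, non-residue resp. `1` mod the odd `ℓ ∣ N_W`), supplied by Dirichlet's theorem
(`Nat.forall_exists_prime_gt_and_eq_mod`); `p ∤ N_W` by good reduction
(`dvd_conductorNorm_iff_not_hasGoodReductionAtPrime`).
[cite: BurungaleCastellaSkinner2025, Lemma 5.2.3] -/
theorem exists_twistSideDiscriminantX9 :
    ∀ (W : WeierstrassCurve ℚ) [W.IsElliptic] [W.IsGloballyMinimal] (p : ℕ) [Fact p.Prime],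
      ClassX9 W p → ∃ dF : ℤ, (1 < dF ∧ Squarefree dF ∧ dF % 4 = 1) ∧ InertInQuadField dF p ∧
        (∀ ℓ : ℕ, ℓ.Prime → ℓ ∣ W.conductorNorm ℤ →
          (p ∣ ℓ + 1 → InertInQuadField dF ℓ) ∧ (¬ p ∣ ℓ + 1 → SplitsInQuadField dF ℓ)) ∧
        (p = 5 → dF ≠ 5) := by
  intro W _ _ p _ hX9
  have hp : p.Prime := Fact.out
  have hp5 : 5 ≤ p := hX9.2.1
  have hp2 : p ≠ 2 := by omega
  -- `p ∤ N_W`: good reduction at `p`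
  have hpN : ¬ p ∣ W.conductorNorm ℤ := fun h =>
    (W.dvd_conductorNorm_iff_not_hasGoodReductionAtPrime p).mp h hX9.2.2.1
  have hN0 : W.conductorNorm ℤ ≠ 0 := by
    have h0 : 0 < W.conductorNorm ℤ := W.conductorNorm_pos_holds
    exact h0.ne'
  -- a quadratic non-residue modulo every odd prime (junk elsewhere)
  have hex : ∀ ℓ : ℕ, ∃ n : ℕ, ℓ.Prime → ℓ ≠ 2 → ¬ IsSquare (n : ZMod ℓ) := by
    intro ℓ
    by_cases h : ℓ.Prime ∧ ℓ ≠ 2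
    · obtain ⟨n, hn⟩ := exists_nat_not_isSquare_zmod h.1 h.2
      exact ⟨n, fun _ _ => hn⟩
    · exact ⟨1, fun h1 h2 => (h ⟨h1, h2⟩).elim⟩
  choose nr hnr using hex
  -- Chinese remainder data: index set = {2, p} ∪ primes of `N_W`; moduli `8`, `p`, `ℓ`
  let t : Finset ℕ := insert 2 (insert p (W.conductorNorm ℤ).primeFactors)
  let s : ℕ → ℕ := fun ℓ => if ℓ = 2 then 8 else ℓ
  let a : ℕ → ℕ := fun ℓ => if ℓ = 2 then 1 else if ℓ = p ∨ p ∣ ℓ + 1 then nr ℓ else 1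
  have h2t : (2 : ℕ) ∈ t := Finset.mem_insert_self _ _
  have hpt : p ∈ t := Finset.mem_insert_of_mem (Finset.mem_insert_self _ _)
  have ht_prime : ∀ ℓ ∈ t, ℓ.Prime := by
    intro ℓ hℓ
    simp only [t, Finset.mem_insert, Nat.mem_primeFactors] at hℓ
    rcases hℓ with rfl | rfl | ⟨h, _, _⟩
    · exact Nat.prime_two
    · exact hp
    · exact h
  have hs0 : ∀ ℓ ∈ t, s ℓ ≠ 0 := by
    intro ℓ hℓ
    simp only [s]
    split_ifs with h
    · norm_num
    · exact (ht_prime ℓ hℓ).ne_zero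
  have hpp : Set.Pairwise (↑t : Set ℕ) (Function.onFun Nat.Coprime s) := by
    intro x hx y hy hxy
    have hxP := ht_prime x hx
    have hyP := ht_prime y hy
    simp only [Function.onFun, s]
    split_ifs with hx2 hy2 hy2
    · exact absurd (hx2.trans hy2.symm) hxy
    · have h2y : Nat.Coprime 2 y := (Nat.coprime_primes Nat.prime_two hyP).mpr (Ne.symm hy2)
      exact Nat.Coprime.pow_left 3 h2y
    · have hx2' : Nat.Coprime x 2 := (Nat.coprime_primes hxP Nat.prime_two).mpr hx2
      exact Nat.Coprime.pow_right 3 hx2'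
    · exact (Nat.coprime_primes hxP hyP).mpr hxy
  obtain ⟨k, hk⟩ := Nat.chineseRemainderOfFinset a s t hs0 hpp
  -- the class `k` is prime to the modulus `M = ∏ s`
  have ha_cop : ∀ ℓ ∈ t, Nat.Coprime (a ℓ) (s ℓ) := by
    intro ℓ hℓ
    by_cases hℓ2 : ℓ = 2
    · simp [a, s, hℓ2]
    · simp only [a, s, hℓ2, if_false]
      split_ifs with h
      · exact ((Nat.Prime.coprime_iff_not_dvd (ht_prime ℓ hℓ)).mpr
          (not_dvd_of_not_isSquare_zmod (hnr ℓ (ht_prime ℓ hℓ) hℓ2))).symm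
      · exact Nat.coprime_one_left ℓ
  have hkM : Nat.Coprime k (∏ i ∈ t, s i) := by
    rw [Nat.coprime_prod_right_iff]
    intro ℓ hℓ
    exact Nat.coprime_iff_gcd_eq_one.mpr
      (((hk ℓ hℓ).gcd_eq).trans (Nat.coprime_iff_gcd_eq_one.mp (ha_cop ℓ hℓ)))
  have hM0 : (∏ i ∈ t, s i) ≠ 0 := Finset.prod_ne_zero_iff.mpr hs0
  haveI : NeZero (∏ i ∈ t, s i) := ⟨hM0⟩
  -- Dirichlet: a prime `q` in the class
  obtain ⟨q, -, hq, hqk⟩ :=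
    Nat.forall_exists_prime_gt_and_eq_mod ((ZMod.isUnit_iff_coprime k _).mpr hkM) 0
  have hqk' : q ≡ k [MOD ∏ i ∈ t, s i] := (ZMod.natCast_eq_natCast_iff _ _ _).mp hqk
  have hqa : ∀ ℓ ∈ t, q ≡ a ℓ [MOD s ℓ] := fun ℓ hℓ =>
    (Nat.ModEq.of_dvd (Finset.dvd_prod_of_mem s hℓ) hqk').trans (hk ℓ hℓ)
  -- read off the congruences
  have h8 : q ≡ 1 [MOD 8] := by simpa [a, s] using hqa 2 h2t
  have h8' : q % 8 = 1 := h8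
  have hqp : q ≡ nr p [MOD p] := by simpa [a, s, hp2] using hqa p hpt
  have hInertP : InertInQuadField (q : ℤ) p :=
    inertInQuadField_of_modEq_nonsquare hp2 hqp (hnr p hp hp2)
  refine ⟨q, ⟨by exact_mod_cast hq.one_lt, Int.squarefree_natCast.mpr hq.prime.squarefree,
    by omega⟩, hInertP, ?_, ?_⟩
  · intro ℓ hℓ hℓN
    have hℓt : ℓ ∈ t := Finset.mem_insert_of_mem
      (Finset.mem_insert_of_mem (Nat.mem_primeFactors.mpr ⟨hℓ, hℓN, hN0⟩))
    have hℓp : ℓ ≠ p := fun h => hpN (h ▸ hℓN)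
    by_cases hℓ2 : ℓ = 2
    · subst hℓ2
      refine ⟨fun h3 => ?_, fun _ => splitsInQuadField_two_of_modEq_one h8⟩
      have h3' : p ≤ 3 := Nat.le_of_dvd (by norm_num) h3
      omega
    · have hqℓ : q ≡ a ℓ [MOD ℓ] := by simpa [s, hℓ2] using hqa ℓ hℓt
      by_cases hpl : p ∣ ℓ + 1
      · have haℓ : a ℓ = nr ℓ := by simp [a, hℓ2, hpl]
        rw [haℓ] at hqℓ
        exact ⟨fun _ => inertInQuadField_of_modEq_nonsquare hℓ2 hqℓ (hnr ℓ hℓ hℓ2),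
          fun h => absurd hpl h⟩
      · have haℓ : a ℓ = 1 := by simp [a, hℓ2, hℓp, hpl]
        rw [haℓ] at hqℓ
        exact ⟨fun h => absurd h hpl, fun _ => splitsInQuadField_of_modEq_one hℓ hℓ2 hqℓ⟩
  · rintro hp5' hq5
    apply hInertP.1
    rw [hq5, hp5']
    norm_num


/-- (F) statement — VERBATIM `CoprimeFrame.Stmt.stub_twistSideDiscriminantX9` of the registered skeleton
(sha `3583344c0151385b…`) of crux `TwistedAnalyticMuZeroCoprimeX9`, re-homed under this Theorems-side
namespace (the skeleton, a pub / `Cruxes/` file, is not importable from `Theorems/`; the two texts are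
syntactically identical under the same `open`s, hence interchangeable by `Iff.rfl`): the real-quadratic
side `d_F` of a BCS-admissible pair exists. A statement abbreviation WITH a kernel-closed witness in
this very module (`stub_twistSideDiscriminantX9`), not a named fact; deliberately without a citation
tag (the cited theorem is `exists_twistSideDiscriminantX9`). -/
abbrev Stmt.stub_twistSideDiscriminantX9 : Prop :=
  ∀ (W : WeierstrassCurve ℚ) [W.IsElliptic] [W.IsGloballyMinimal] (p : ℕ) [Fact p.Prime],
    ClassX9 W p → ∃ dF : ℤ, (1 < dF ∧ Squarefree dF ∧ dF % 4 = 1) ∧ InertInQuadField dF p ∧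
      (∀ ℓ : ℕ, ℓ.Prime → ℓ ∣ W.conductorNorm ℤ →
        (p ∣ ℓ + 1 → InertInQuadField dF ℓ) ∧ (¬ p ∣ ℓ + 1 → SplitsInQuadField dF ℓ)) ∧
      (p = 5 → dF ≠ 5)

/-- ★ **Registered stub (F) `stub_twistSideDiscriminantX9` of line `coprime-frame` (crux
`TwistedAnalyticMuZeroCoprimeX9`, route `SignedBalanceX9`, item stmt-BirchSwinnertonDyer-25216), BY
NAME AND SIGNATURE, unconditional** — Burungale–Castella–Skinner 2025 Lemma 5.2.3, `F`-side:
`exists_twistSideDiscriminantX9`. Owner's discharge in the skeleton: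
`theorem stub_twistSideDiscriminantX9 : Stmt.stub_twistSideDiscriminantX9 :=
Summit.BirchSwinnertonDyer.BirchSwinnertonDyer.Theorems.SignedBalanceX9CoprimeFrame.exists_twistSideDiscriminantX9`.
[cite: BurungaleCastellaSkinner2025, Lemma 5.2.3] -/
theorem stub_twistSideDiscriminantX9 : Stmt.stub_twistSideDiscriminantX9 :=
  exists_twistSideDiscriminantX9

end Summit.BirchSwinnertonDyer.BirchSwinnertonDyer.Theorems.SignedBalanceX9CoprimeFrame
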